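import Summits.Ventures.AbcSig.Rows.XTemplateC2a
import Summits.Ventures.AbcSig.Rows.XTemplateAB
import Summits.Ventures.AbcSig.Rows.XTemplateBC
import Summits.Ventures.AbcSig.Recipes.E3Package

/-!
# Venture AbcSig — EXTENDED row templates, E3 sub-class: `ord₂ B = 6`, `y` even sieved at the ODD level (p-lean g6)

HONEST FRAMING. Templates of a COMPUTATION cell (`pub-abcsig`): CONDITIONAL theorems over the abstract `NewformModel`;
no claim on ABC or any summit. Twins of the case-(v₇) branches of `Rows/XTemplateB.lean` (`xbranch_v7`),
`Rows/XTemplateAB.lean` (`xbranchAB_v7`) and `Rows/XTemplateBC.lean` (`xbranchBC_v7`) and of the class-`a = 6` rows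
`xrowC2a_a6` / `xrowC2aAB_a6` in which the sub-class "`ord₂ B = 6`, `y` even" is sent to the ODD level
`bs04OddLevel A B C n` (`ℓ` resp. `C²`) by the named CITED hypothesis `NewformModel.E3Package` (`Recipes/E3Package.lean`:
ERRATA E3 / referee record `referee/E3-LEVEL-LEMMA.md` — the Serre conductor of `ρ^E_n` is odd there) instead of the
printed level `2 · (odd part)` of [BS04, Lemma 3.2/3.3] used by the originals. Consequence for the rows built on them
(`Rows/…E.lean`): the whole class `a = 6` (both parities of `y`) is sieved at ONE level, the odd one, exactly as the rows
of record do ("class b-even, t = 6 [E3-dependent]: Serre level → core (decisive); the 2·core sieve is informational");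
the informational level, its `DataComplete` hypothesis and its uncertified cited survivors disappear from the theorem.
Hypotheses of every theorem here: `BS04Package` (CITED) for the trace congruences, `E3Package` (CITED) for the level,
`DataComplete` at the odd level (COMPUTED), and the per-orbit disjunction (kernel certificate ∨ cited `Excludes` ∨
`ExcludesStd`) exactly as in the X-templates.
Consumers: the E-variant rows/cells `Rows/C2aL59A6eqXE*.lean`, `Rows/Xn64Yn17Z2XE*.lean`, `Rows/Xn64Yn15Z2QE*.lean`,
`Rows/Xn64Yn19Z2QE*.lean` (p-lean g6, plan `plean/g6/gen6/plan_e3.jsonl`; submitted by p-lean g7).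
-/

namespace Summit.Ventures.AbcSig

/-- **Branch (v₇) at the ODD level (E3), coefficients `(1, B, 1)`:** `ord₂ B = 6`, `2⁷ ∣ B yⁿ` (so `y` even), level
`N = bs04OddLevel 1 B 1 n`. -/
theorem xbranch_v7E3 (B : ℕ) (hB : 0 < B) (M : NewformModel) (hP : M.BS04Package) (hE3 : M.E3Package) (n : ℕ)
    (hn : n.Prime) (h7 : 7 ≤ n) (hnB : ¬ n ∣ B) (hfreeB : ∀ q : ℕ, q.Prime → ¬ q ^ n ∣ B)
    (hB6 : OrdTwoEq (B : ℤ) 6) (N : ℕ) (hN : bs04OddLevel 1 B 1 n = N) (P : ℤ → ℤ → Prop)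
    {orbs : List OrbitData} (hD : M.DataComplete N orbs)
    (hS : ∀ o ∈ orbs, (∀ e ∈ o.coeffs, e.ell.Prime ∧ e.ell ≠ 2 ∧ ¬ e.ell ∣ N) ∧
      (o.Eliminated bs04Allowed n ∨ (M.Excludes N o (famB B n P) ∨ M.ExcludesStd N o n)))
    (x y z : ℤ) (hPxy : P x y) (hv : (2 : ℤ) ^ 7 ∣ B * y ^ n) (hxy1 : x * y ≠ 1) (hxy2 : x * y ≠ -1) :
    ¬ IsPrimitiveSolution 1 B 1 n x y z := by
  intro hsol
  have h2 : 2 ∣ (B : ℤ) * y := two_dvd_By_of_pow ((dvd_pow_self 2 (by norm_num)).trans hv)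
  have hz := odd_z_of_two_dvd_By hsol h2
  obtain ⟨z', hz'sgn, hz'⟩ := exists_sign_sub_four_dvd_int z 1 hz (by omega)
  have hsol' : IsPrimitiveSolution 1 B 1 n x y z' := hsol.of_sign hz'sgn
  have hcase : FreyCase.Holds .v₇ 1 B 1 n x y z' := ⟨hv, by simpa using hz'⟩
  exact M.xno_solution_in_caseE3 hP hE3 ⟨1, B, 1, n, x, y, z'⟩ N one_pos hB one_pos squarefree_one hn h7
    (by simpa using hnB) (nthPowerFree_one B n (by omega) hfreeB) hsol' hxy1 hxy2 hcase hB6 hN hD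
    (famB B n P) ⟨Or.inl ⟨rfl, rfl, hPxy⟩, rfl, rfl⟩ hS

/-- **Branch (v₇) at the ODD level (E3), coefficients `(A, B)`:** `ord₂ B = 6`, `2⁷ ∣ B yⁿ`, level
`N = bs04OddLevel A B 1 n`. -/
theorem xbranchAB_v7E3 (A B : ℕ) (hA : 0 < A) (hB : 0 < B) (M : NewformModel) (hP : M.BS04Package)
    (hE3 : M.E3Package) (n : ℕ) (hn : n.Prime) (h7 : 7 ≤ n) (hnAB : ¬ n ∣ A * B)
    (hfree : ∀ q : ℕ, q.Prime → ¬ q ^ n ∣ A ∧ ¬ q ^ n ∣ B) (hB6 : OrdTwoEq (B : ℤ) 6)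
    (N : ℕ) (hN : bs04OddLevel A B 1 n = N) (P : ℤ → ℤ → Prop) {orbs : List OrbitData}
    (hD : M.DataComplete N orbs)
    (hS : ∀ o ∈ orbs, (∀ e ∈ o.coeffs, e.ell.Prime ∧ e.ell ≠ 2 ∧ ¬ e.ell ∣ N) ∧
      (o.Eliminated bs04Allowed n ∨ (M.Excludes N o (famAB A B n P) ∨ M.ExcludesStd N o n)))
    (x y z : ℤ) (hPxy : P x y) (hv : (2 : ℤ) ^ 7 ∣ B * y ^ n) (hxy1 : x * y ≠ 1) (hxy2 : x * y ≠ -1) :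
    ¬ IsPrimitiveSolution A B 1 n x y z := by
  intro hsol
  have h2 : 2 ∣ (B : ℤ) * y := two_dvd_By_of_pow ((dvd_pow_self 2 (by norm_num)).trans hv)
  have hz := odd_z_of_two_dvd_By' hsol h2
  obtain ⟨z', hz'sgn, hz'⟩ := exists_sign_sub_four_dvd_int z 1 hz (by omega)
  have hsol' : IsPrimitiveSolution A B 1 n x y z' := hsol.of_sign hz'sgn
  have hcase : FreyCase.Holds .v₇ A B 1 n x y z' := ⟨hv, by simpa using hz'⟩
  exact M.xno_solution_in_caseE3 hP hE3 ⟨A, B, 1, n, x, y, z'⟩ N hA hB one_pos squarefree_one hn h7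
    (by simpa using hnAB) hfree hsol' hxy1 hxy2 hcase hB6 hN hD (famAB A B n P) ⟨Or.inl ⟨rfl, rfl, hPxy⟩, rfl, rfl⟩ hS

/-- **Branch (v₇) at the ODD level (E3), `xⁿ + 2⁶ yⁿ = C z²` with `y` even:** odd squarefree `C`, level `C²`. -/
theorem xbranchBC_v7E3 (C : ℕ) (hsq : Squarefree C) (hCodd : Odd C) (M : NewformModel) (hP : M.BS04Package)
    (hE3 : M.E3Package) {orbs : List OrbitData} (hD : M.DataComplete (C ^ 2) orbs)
    (n : ℕ) (hn : n.Prime) (h7 : 7 ≤ n) (hnC : ¬ n ∣ C)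
    (hS : ∀ o ∈ orbs, (∀ e ∈ o.coeffs, e.ell.Prime ∧ e.ell ≠ 2 ∧ ¬ e.ell ∣ C ^ 2) ∧
      (o.Eliminated bs04Allowed n ∨ (M.Excludes (C ^ 2) o (famBC 6 C n (fun _ b => 2 ∣ b)) ∨
        M.ExcludesStd (C ^ 2) o n)))
    (x y z : ℤ) (hy : 2 ∣ y) (h1 : x * y ≠ 1) (h2 : x * y ≠ -1) :
    ¬ IsPrimitiveSolution 1 (2 ^ 6) C n x y z := by
  intro hsol
  have hCpos : 0 < C := hCodd.pos
  have hCoddZ : ¬ 2 ∣ (C : ℤ) := by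
    intro h
    have h' : (2 : ℕ) ∣ C := by exact_mod_cast h
    exact (Nat.not_even_iff_odd.mpr hCodd) (even_iff_two_dvd.mpr h')
  have hBb : 2 ∣ ((2 ^ 6 : ℕ) : ℤ) * y := Dvd.dvd.mul_left hy _
  have hCz := odd_Cc_of_two_dvd_Bb hsol hBb
  have hz : ¬ 2 ∣ z := fun h => hCz (Dvd.dvd.mul_left h _)
  obtain ⟨z', hz'sgn, hz'⟩ := exists_sign_sub_four_dvd z C hz hCoddZ
  have hsol' : IsPrimitiveSolution 1 (2 ^ 6) C n x y z' := hsol.of_sign hz'sgn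
  have hv : (2 : ℤ) ^ 7 ∣ ((2 ^ 6 : ℕ) : ℤ) * y ^ n :=
    Dvd.dvd.mul_left ((pow_dvd_pow 2 h7).trans (pow_dvd_pow_of_dvd hy n)) _
  have hcase : FreyCase.Holds .v₇ 1 (2 ^ 6) C n x y z' := ⟨hv, hz'⟩
  have hndvd : ¬ n ∣ 1 * 2 ^ 6 * C := by
    intro h
    rw [one_mul] at h
    rcases (Nat.Prime.dvd_mul hn).mp h with h2 | hC
    · have := (Nat.prime_dvd_prime_iff_eq hn Nat.prime_two).mp (hn.dvd_of_dvd_pow h2)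
      omega
    · exact hnC hC
  have hB6 : OrdTwoEq (((2 ^ 6 : ℕ)) : ℤ) 6 := by
    have h := ordTwoEq_twoPow_mul_odd 6 1 (by decide)
    rw [mul_one] at h
    exact_mod_cast h
  exact M.xno_solution_in_caseE3 hP hE3 ⟨1, 2 ^ 6, C, n, x, y, z'⟩ (C ^ 2) one_pos (by positivity) hCpos hsq hn h7
    hndvd (nthPowerFree_one_twoPow 6 n (by omega) (by omega)) hsol' h1 h2 hcase hB6
    (bs04OddLevel_one_twoPow 6 C n hsq hCodd hnC) hD (famBC 6 C n (fun _ b => 2 ∣ b)) ⟨rfl, rfl, rfl, rfl, hy⟩ hS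

/-- **Class `a = 6`, first distribution, E3 form:** `xⁿ + 2⁶ℓ^m·yⁿ = z²` sieved at the single ODD level `ℓ` for both
parities of `y` (`y` odd: case (v₆), printed level `ℓ`; `y` even: case (v₇), level `ℓ` by `E3Package`). -/
theorem xrowC2a_a6E3 (ℓ : ℕ) (hℓ : ℓ.Prime) (hℓ2 : ℓ ≠ 2) (M : NewformModel) (hP : M.BS04Package)
    (hE3 : M.E3Package) (n : ℕ) (hn : n.Prime) (h7 : 7 ≤ n) (hnℓ : n ≠ ℓ) {orbs1 : List OrbitData}
    (hD1 : M.DataComplete ℓ orbs1) (m : ℕ) (hm : 1 ≤ m) (hmn : m < n)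
    (hS1 : ∀ o ∈ orbs1, (∀ e ∈ o.coeffs, e.ell.Prime ∧ e.ell ≠ 2 ∧ ¬ e.ell ∣ ℓ) ∧
      (o.Eliminated bs04Allowed n ∨ (M.Excludes ℓ o (famB (2 ^ 6 * ℓ ^ m) n (fun _ _ => True)) ∨ M.ExcludesStd ℓ o n)))
    (x y z : ℤ) (hxy1 : x * y ≠ 1) (hxy2 : x * y ≠ -1) : ¬ IsPrimitiveSolution 1 (2 ^ 6 * ℓ ^ m) 1 n x y z := by
  intro hsol
  have hB : 0 < 2 ^ 6 * ℓ ^ m := by have := hℓ.pos; positivity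
  have hnB := not_dvd_twoPow_primePow ℓ 6 m n hℓ hn (by omega) hnℓ
  have hfreeB := nthPowerFree_twoPow_primePow ℓ 6 m n hℓ hℓ2 (by omega) hmn
  obtain ⟨-, hL1, -⟩ := levelsC2a ℓ hℓ hℓ2 n hnℓ 6 m hm
  have hℓodd := prime_odd_int ℓ hℓ hℓ2
  have hOdd : bs04OddLevel 1 (2 ^ 6 * ℓ ^ m) 1 n = ℓ := (bs04OddLevel_twoPow_primePow ℓ 6 m n hℓ hℓ2 hm hnℓ).1
  have hB6 : OrdTwoEq (((2 ^ 6 * ℓ ^ m : ℕ)) : ℤ) 6 := by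
    have : ((2 ^ 6 * ℓ ^ m : ℕ) : ℤ) = 2 ^ 6 * (ℓ : ℤ) ^ m := by push_cast; ring
    rw [this]
    exact ordTwoEq_twoPow_mul_odd 6 _ (not_two_dvd_pow hℓodd m)
  by_cases hy : 2 ∣ y
  · have hv : (2 : ℤ) ^ 7 ∣ ((2 ^ 6 * ℓ ^ m : ℕ) : ℤ) * y ^ n :=
      Dvd.dvd.mul_left ((pow_dvd_pow 2 h7).trans (pow_dvd_pow_of_dvd hy n)) _
    exact xbranch_v7E3 _ hB M hP hE3 n hn h7 hnB hfreeB hB6 ℓ hOdd (fun _ _ => True) hD1 hS1 x y z trivial hv hxy1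
      hxy2 hsol
  · have hv : OrdTwoEq (((2 ^ 6 * ℓ ^ m : ℕ) : ℤ) * y ^ n) 6 := by
      have : ((2 ^ 6 * ℓ ^ m : ℕ) : ℤ) * y ^ n = 2 ^ 6 * ((ℓ : ℤ) ^ m * y ^ n) := by push_cast; ring
      rw [this]
      exact ordTwoEq_twoPow_mul_odd 6 _ (not_two_dvd_mul (not_two_dvd_pow hℓodd m) (not_two_dvd_pow hy n))
    exact xbranch_v6 _ hB M hP n hn h7 hnB hfreeB ℓ hL1 (fun _ _ => True) hD1 hS1 x y z trivial hv hxy1 hxy2 hsol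

/-- **Class `a = 6`, second distribution `(ℓ^m, 2⁶)`, E3 form:** `ℓ^m·xⁿ + 2⁶·yⁿ = z²` at the single odd level `ℓ`. -/
theorem xrowC2aAB_a6E3 (ℓ : ℕ) (hℓ : ℓ.Prime) (hℓ2 : ℓ ≠ 2) (M : NewformModel) (hP : M.BS04Package)
    (hE3 : M.E3Package) (n : ℕ) (hn : n.Prime) (h7 : 7 ≤ n) (hnℓ : n ≠ ℓ) {orbs1 : List OrbitData}
    (hD1 : M.DataComplete ℓ orbs1) (m : ℕ) (hm : 1 ≤ m) (hmn : m < n)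
    (hS1 : ∀ o ∈ orbs1, (∀ e ∈ o.coeffs, e.ell.Prime ∧ e.ell ≠ 2 ∧ ¬ e.ell ∣ ℓ) ∧
      (o.Eliminated bs04Allowed n ∨ (M.Excludes ℓ o (famAB (ℓ ^ m) (2 ^ 6) n (fun _ _ => True)) ∨ M.ExcludesStd ℓ o n)))
    (x y z : ℤ) (hxy1 : x * y ≠ 1) (hxy2 : x * y ≠ -1) : ¬ IsPrimitiveSolution (ℓ ^ m) (2 ^ 6) 1 n x y z := by
  intro hsol
  obtain ⟨hA, hB, hnAB, hfree⟩ := sideAB ℓ 6 m n hℓ hℓ2 hn (by omega) hnℓ (by omega) hmn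
  obtain ⟨-, hL1, -⟩ := levelsC2aAB ℓ hℓ hℓ2 n hnℓ 6 m hm
  have hOdd : bs04OddLevel (ℓ ^ m) (2 ^ 6) 1 n = ℓ := by
    simpa [bs04Level, FreyCase.twoExp] using hL1
  have hB6 : OrdTwoEq (((2 ^ 6 : ℕ)) : ℤ) 6 := by
    have h := ordTwoEq_twoPow_mul_odd 6 1 (by decide)
    rw [mul_one] at h
    exact_mod_cast h
  by_cases hy : 2 ∣ y
  · have hv : (2 : ℤ) ^ 7 ∣ ((2 ^ 6 : ℕ) : ℤ) * y ^ n :=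
      Dvd.dvd.mul_left ((pow_dvd_pow 2 h7).trans (pow_dvd_pow_of_dvd hy n)) _
    exact xbranchAB_v7E3 _ _ hA hB M hP hE3 n hn h7 hnAB hfree hB6 ℓ hOdd (fun _ _ => True) hD1 hS1 x y z trivial hv
      hxy1 hxy2 hsol
  · have hv : OrdTwoEq (((2 ^ 6 : ℕ) : ℤ) * y ^ n) 6 := by
      push_cast
      exact ordTwoEq_twoPow_mul_odd 6 _ (not_two_dvd_pow hy n)
    exact xbranchAB_v6 _ _ hA hB M hP n hn h7 hnAB hfree ℓ hL1 (fun _ _ => True) hD1 hS1 x y z trivial hv hxy1 hxy2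
      hsol

end Summit.Ventures.AbcSig
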